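import Summits.Ventures.PercRepro.S2ElevenEightK2NuFourSimpleEightTop

/-!
# PercRepro — S2: THE CASE `ν = 4` OF THE COLOOP-FREE CELL `(13, 8)`, PART (IV) AT `w = 8`: THE CONTRACTION IS SIMPLE — THE CELL SIDE (p7, gen 18; sub-claim S2)

Part (IV) of the case `ν = 4`: no set of nullity `5` on `≤ 11` points, and the nullity-`4` flat `W` has `8` points (rank `4`). Then
`N = M ／ W` (nullity `4` on `11` points) is SIMPLE: a dependent pair `{x, y}` would make `W ∪ {x, y}` a set of nullity `5` on `10`
points. The exact-rank lever on `W` with the counts of a simple matroid (S2NuFourSimpleCounts, S2RankClasses): no rank-`≤ 1` set with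
`≥ 2` points, the dependent triples are `3`-circuits (`≤ 20`), the dependent `4`-sets `≤ 20·8 + 35`, the rank-`≤ 2` `4`-sets `≤ 60`.
`#U ≤ 32640`, `#spanning ≤ 106571`, the tail by flats at `(9, 8)` `= 14845369 / 180`, `m = 370`. **`c025_eleven_eight_k2_nu_four_simple_eight`**.
Nothing about the cell is claimed. Axioms: standard.
The top count `#U` is the theorem of S2ElevenEightK2NuFourSimpleEightTop; here the spanning count, the tail by flats at `(9, 8)` and the cell inequality.
-/

open scoped Matroid

namespace PercRepro

namespace ThmN

open Set

variable {α : Type}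

/-- **Part (IV) of the case `ν = 4` of the twice-scaled cell `(11, 8)` of `(13, 8)` at `K₂ = 12107` (coloops allowed) at `w = 8`**: no set of nullity `5` on `≤ 11` points and a nullity-`4` flat of `8` points, whose contraction is simple (`#U ≤ 32640`, `m = 370`). -/
theorem c025_eleven_eight_k2_nu_four_simple_eight (M : Matroid α) [M.Finite]
    (hR : M.eRank = ((11 : ℕ) : ℕ∞)) (hn : M.E.ncard = 11 + 8)
    (hfree : ∀ e ∈ M.E, ∃ A ⊆ M.E \ {e}, e ∉ M.closure A ∧ e ∉ M.closure ((M.E \ {e}) \ A))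
    (hno11 : ¬ ∃ V ⊆ M.E, V.ncard ≤ 11 ∧ V.encard = M.eRk V + 5)
    (hV : ∃ V ⊆ M.E, V.ncard = 8 ∧ V.encard = M.eRk V + 4) :
    ((phiK 13 5 - 6) / 4) * (Matroid.topCount M 11 5 : ℚ) ≤ (Matroid.midCount M 11 5 : ℚ) := by
  classical
  have hU' := c025_eleven_eight_k2_nu_four_simple_eight_top M hR hn hfree hno11 hV
  have hd : M.E.encard = M.eRank + ((8 : ℕ) : ℕ∞) := by
    rw [hR, ← M.ground_finite.cast_ncard_eq, hn]
    push_cast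
    ring
  obtain ⟨hs3, hs4, hs5⟩ := caps_eleven_eight M hd hfree
  have hEfin := M.ground_finite
  have hL0 : ∀ e ∈ M.E, ¬ M.IsLoop e := not_isLoop_of_free M hfree
  have hs : ∀ e ∈ M.E, ∀ f ∈ M.E, e ≠ f → M.eRk {e, f} = 2 := by
    intro e he f hf hef
    have h2 : (2 : ℕ∞) ≤ M.eRk {e, f} :=
      two_le_eRk_of_two_le_ncard_of_free M hfree (pair_subset he hf) (by rw [ncard_pair hef])
    have h3 : M.eRk {e, f} ≤ 2 := by
      have := M.eRk_le_encard {e, f}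
      rwa [encard_pair hef] at this
    exact le_antisymm h3 h2
  have hC1 : ∀ L ⊆ M.E, M.eRk L = 2 → L.ncard ≤ 3 :=
    fun L hL hr => ncard_le_three_of_eRk_two M hs hfree hL hr
  have h5 : ¬ ∃ W ⊆ M.E, W.ncard ≤ 10 ∧ W.encard = M.eRk W + 5 := fun ⟨W, hW, hWn, hWk⟩ => hno11 ⟨W, hW, by omega, hWk⟩
  have hflat : ∀ X ⊆ M.E, M.eRk X ≤ 5 → X.ncard ≤ 9 := fun X hX hr => by
    have := S2.ncard_le_of_eRk_le_of_not_nullity M 5 10 (by norm_num) h5 hX (r := 5) (by norm_num) (by exact_mod_cast hr)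
    omega
  have hflat' : ∀ X ⊆ M.E, M.eRk X ≤ 4 → X.ncard ≤ 8 := fun X hX hr => by
    have := S2.ncard_le_of_eRk_le_of_not_nullity M 5 10 (by norm_num) h5 hX (r := 4) (by norm_num) (by exact_mod_cast hr)
    omega
  -- the set `V`: the nullity-`4` flat of `8` points (rank `4`)
  obtain ⟨V, hV, hw, hVk⟩ := hV
  have hVfin0 : V.Finite := hEfin.subset hV
  have hVne : M.eRk V ≠ ⊤ := ((M.eRk_le_encard V).trans_lt hVfin0.encard_lt_top).ne
  have hr : M.eRk V = ((4 : ℕ) : ℕ∞) := by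
    have h := hVk
    rw [← hVfin0.cast_ncard_eq, hw] at h
    have h2 : ((8 : ℕ) : ℕ∞) = ((4 : ℕ) : ℕ∞) + 4 := by norm_num
    rw [h2] at h
    exact (WithTop.add_right_cancel (by decide) h).symm
  have hVcl : M.closure V = V := by
    refine le_antisymm ?_ (M.subset_closure V hV)
    intro x hx
    by_contra hxV
    have hxE : x ∈ M.E := M.closure_subset_ground V hx
    apply hno11
    refine ⟨insert x V, Set.insert_subset hxE hV, ?_, ?_⟩
    · rw [Set.ncard_insert_of_notMem hxV hVfin0]; omega
    · rw [Set.encard_insert_of_notMem hxV, ← M.eRk_closure_eq, M.closure_insert_eq_of_mem_closure hx,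
        M.eRk_closure_eq, hVk]
      ring
  have hVE : V ⊆ M.E := hV
  have hS := S2.ncard_spanning_le_of_nullity M hVE hd hVk
  rw [hn, hw] at hS
  have hS' : {X : Set α | X ⊆ M.E ∧ M.eRk X = M.eRank}.ncard ≤ 106571 := hS.trans (by decide)
  have hA := ncard_eRk_le_five_le_flats M 11 8 (by norm_num) hR hn hfree 9 8 hflat hflat' (by norm_num) (by norm_num)
    (by norm_num) (by norm_num) 13 99 651 hs3 hs4 hs5
  have hA' : ({X : Set α | X ⊆ M.E ∧ M.eRk X ≤ 5}.ncard : ℚ) ≤ 14845369 / 180 := by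
    norm_num [Finset.sum_range_succ, Nat.choose] at hA
    linarith only [hA]
  exact c025_core_five_cell_of_counts_xqictq5g M 11 8 (by norm_num) hR hn 32640 hU' _ hA' 106571 hS'
    12107 (by norm_num) ((phiK 13 5 - 6) / 4) (by rw [phiK_thirteen_five]; norm_num) ⟨370, by norm_num, by norm_num, by norm_num⟩

end ThmN

end PercRepro
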